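import Literature.AlgebraicGeometry.Smoothening.SmoothAffineChartKaehlerBasis
import Literature.AlgebraicGeometry.Smoothening.NeronPropertyCodimOne
import Literature.AlgebraicGeometry.Motives.TopFormCocycleUnitAt
import Literature.AlgebraicGeometry.Motives.SmoothLocalCoordinates
import Literature.RingTheory.Localization.KaehlerBaseLocalization
import Mathlib.AlgebraicGeometry.Morphisms.Flat
import Mathlib.AlgebraicGeometry.FunctionField
import Mathlib.RingTheory.Kaehler.TensorProduct
import Mathlib.Algebra.Category.Ring.Constructions
import HarnessLib

/-!
# Relative rational coordinates on `𝒳 ×_R 𝒳` over the first factor (road W, node (W0) C5′)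

Topic `Literature/AlgebraicGeometry/Motives`, namespace `Literature.AlgebraicGeometry.Motives`.
THEOREMS ONLY.  Cell `hodgecm-mathlib` (D-0151), fan B-III (T1) road W, sub-line `koizumi_strictly_local`,
node (W0) «the group law of `A_K` is an `R`-birational group law on a smooth proper model», B-p18's core
decomposition v2 (`W0CoreStubsV2` b2ea4f3b), leaf **`stub_C5'`**: for rational coordinates `y` on `𝒳` over
`R` (`d yᵢ` a basis of `Ω[K(𝒳)⁄R]`), the functions `pr₂^♯ yᵢ` are rational coordinates on `Y = 𝒳 ⊗ 𝒳`
relative to the first factor — `d (pr₂^♯ yᵢ)` is a basis of `Ω[K(Y)⁄K(𝒳)]` for `K(𝒳) → K(Y) := pr₁^♯`.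
Banked leaf toward road W (r₀); no floor change.

## Proof (no charts of `E = 𝒳_K`, no `Spec`-level chart maps — sections and germs only)

1. (C1 ★ `Smoothening.exists_affineChart_basis_eq_D`) an affine chart `V ∋ η` of `𝒳` smooth of relative
   dimension `n` with an exact basis `d y*` of `Ω[Γ(V)⁄R]`.
2. `W := pr₁⁻¹V ∩ pr₂⁻¹V`, `C := Γ(Y, W)`: by Mathlib's sections-of-fibre-products theorem
   (`isIso_pushoutSection_of_isAffineOpen`) `C` is the pushout `Γ(V) ⊗_R Γ(V)` of the two charts — stated with
   two chart opens `V₁`, `V₂` so that the two `Γ(Vᵢ)`-algebra structures on `C` never collide — hence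
   `Ω[C⁄Γ(V₁)]` has the basis `d (pr₂^♯ y*)` (`KaehlerDifferential.tensorKaehlerEquiv`, BLR §2.1 Prop. 3).
3. `K(Y) = Frac C` (Mathlib `functionField_isFractionRing_of_isAffineOpen`): `Ω` commutes with localisation
   (★ `exists_basis_kaehler_localization_eq_D`), and with localisation OF THE BASE `Γ(V₁) → K(𝒳)`
   (★ `kaehlerDifferentialEquivOfIsLocalization`): `d_{K(𝒳)} (pr₂^♯ y*ᵢ)` is a basis of `Ω[K(Y)⁄K(𝒳)]`.
4. ARBITRARY rational coordinates `y`: the chain rule along the ring map `pr₂^♯` (★ `det_D_ringHom_eq`)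
   gives `W′.det (d pr₂^♯ yⱼ)ⱼ = pr₂^♯ (B′.det (d yⱼ)ⱼ)`, a unit, so `(d pr₂^♯ yⱼ)` is a basis
   (Mathlib `is_basis_iff_det`).  No second `K(𝒳)`-module structure on `Ω[K(Y)⁄K(𝒳)]` is ever used.

## References
* S. Bosch, W. Lütkebohmert, M. Raynaud, *Néron Models*, Springer 1990, §2.1 Prop. 3 (`Ω` and base change /
  localisation), §2.2 Prop. 11. [BLRNeronModels1990]
* U. Görtz, T. Wedhorn, *Algebraic Geometry I*, 2nd ed. (2020), (11.16), Prop. 3.29. [GortzWedhorn2020]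
-/

noncomputable section

universe u

open CategoryTheory CategoryTheory.Limits AlgebraicGeometry MonoidalCategory CartesianMonoidalCategory
open TopologicalSpace

namespace Literature.AlgebraicGeometry.Motives

open RatFn Literature.AlgebraicGeometry.Smoothening

/-! ### §0 Germs, stalk maps and the `R`-algebra structures -/

section Germs

variable {X Y : Scheme.{u}} [IsIntegral X] [IsIntegral Y]

/-- **Germs of pulled-back sections**: for a dominant `f : X → Y`, `V ≤ f⁻¹U` and `s ∈ Γ(Y, U)`, the germ at
the generic point of `f^*(s)|_V` is `f^♯` of the germ of `s` (Görtz–Wedhorn I, (11.16)).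
-- adapted from `Literature/AlgebraicGeometry/RelativeSpec/FiniteGroupQuotientGenericEtale.lean`
[cite: GortzWedhorn2020, (11.16)] -/
private theorem germ_appLE_eq_functionFieldMap (f : X ⟶ Y) [IsDominant f] {U : Y.Opens}
    {V : X.Opens} (e : V ≤ f ⁻¹ᵁ U) (hU : genericPoint Y ∈ U) (hV : genericPoint X ∈ V)
    (s : Γ(Y, U)) :
    X.presheaf.germ V (genericPoint X) hV (f.appLE U V e s) =
      functionFieldMap f (Y.presheaf.germ U (genericPoint Y) hU s) := by
  have h1 : f (genericPoint X) ∈ U := by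
    rw [genericPoint_eq_of_isDominant f]
    exact hU
  have e1 : Y.presheaf.germ U (genericPoint Y) hU s =
      toFunctionField (f (genericPoint X)) (Y.presheaf.germ U _ h1 s) := by
    simp only [toFunctionField, RingHom.algebraMap_toAlgebra]
    exact (TopCat.Presheaf.germ_stalkSpecializes_apply Y.presheaf _ _ s).symm
  rw [e1, functionFieldMap_toFunctionField, Scheme.Hom.germ_stalkMap_apply]
  simp only [toFunctionField, RingHom.algebraMap_toAlgebra, Scheme.Hom.appLE,
    CommRingCat.comp_apply]
  rw [TopCat.Presheaf.germ_res_apply X.presheaf]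
  exact (TopCat.Presheaf.germ_stalkSpecializes_apply X.presheaf _ _ _).symm

/-- The generic point of an integral scheme lies in every non-empty open. [folklore] -/
private theorem genericPoint_mem_opens_of_nonempty (U : X.Opens) [h : Nonempty U] : genericPoint X ∈ U :=
  ((genericPoint_spec X).mem_open_set_iff U.isOpen).mpr (by simpa using h)

end Germs

section StalkHom

variable {R : Type u} [CommRing R]

/-- The stalk maps of a morphism of `R`-schemes are `R`-algebra maps for the structure maps
`stalkHom`: `f_y^♯ ∘ (R → 𝒪_{𝒳, f y}) = (R → 𝒪_{𝒴, y})` (a morphism of `R`-schemes is a morphism of locally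
ringed spaces over `Spec R`; Hartshorne II §2, Görtz–Wedhorn I (3.4)/(3.5)). [cite: GortzWedhorn2020, (3.4)–(3.5) with (11.16)] -/
theorem stalkMap_comp_stalkHom {𝒳 𝒴 : Over (Spec (.of R))} (f : 𝒴 ⟶ 𝒳) (y : 𝒴.left) :
    (f.left.stalkMap y).hom.comp (stalkHom 𝒳 (f.left y)) = stalkHom 𝒴 y := by
  ext r
  simp only [stalkHom, globalHom, RingHom.coe_comp, Function.comp_apply]
  rw [Scheme.Hom.germ_stalkMap_apply]
  have hw : f.left ≫ 𝒳.hom = 𝒴.hom := Over.w f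
  have happ : (f.left.app ⊤) (𝒳.hom.appTop ((Scheme.ΓSpecIso (.of R)).inv r)) =
      𝒴.hom.appTop ((Scheme.ΓSpecIso (.of R)).inv r) := by
    rw [← hw, Scheme.Hom.comp_appTop]
    rfl
  rw [happ]
  rfl

/-- On function fields: for a morphism `f : 𝒴 → 𝒳` of integral `R`-schemes with dominant underlying map,
`f^♯ : K(𝒳) → K(𝒴)` is an `R`-algebra map for the structure maps `stalkHom` at the generic points
(Görtz–Wedhorn I, (11.16): the extension `K(X) → K(X')` of `𝒪_X → f_*𝒪_{X'}`). [cite: GortzWedhorn2020, (11.16)] -/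
theorem functionFieldMap_comp_stalkHom {𝒳 𝒴 : Over (Spec (.of R))} [IsIntegral 𝒳.left]
    [IsIntegral 𝒴.left] (f : 𝒴 ⟶ 𝒳) [IsDominant f.left] :
    (functionFieldMap f.left).comp (stalkHom 𝒳 (genericPoint 𝒳.left)) =
      stalkHom 𝒴 (genericPoint 𝒴.left) := by
  rw [← stalkMap_comp_stalkHom f (genericPoint 𝒴.left)]
  ext r
  simp only [functionFieldMap, stalkHom, globalHom, RingHom.coe_comp, Function.comp_apply,
    CommRingCat.hom_comp]
  congr 1
  exact TopCat.Presheaf.germ_stalkSpecializes_apply 𝒳.left.presheaf _ _ _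

/-- The chart algebra structure `R → Γ(𝒳, V)` (`Spec`-iso followed by `appLE`) composed with the germ map
`Γ(𝒳, V) → K(𝒳)` is the structure map `stalkHom` at the generic point. [folklore] -/
private theorem germ_comp_chartAlgebraMap (𝒳 : Over (Spec (.of R))) [IsIntegral 𝒳.left] (V : 𝒳.left.Opens)
    (hη : genericPoint 𝒳.left ∈ V) :
    (𝒳.left.presheaf.germ V (genericPoint 𝒳.left) hη).hom.comp
        ((Scheme.ΓSpecIso (.of R)).inv ≫ 𝒳.hom.appLE ⊤ V le_top).hom =
      stalkHom 𝒳 (genericPoint 𝒳.left) := by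
  ext r
  simp only [stalkHom, globalHom, RingHom.coe_comp, Function.comp_apply, CommRingCat.hom_comp,
    Scheme.Hom.appLE]
  exact TopCat.Presheaf.germ_res_apply 𝒳.left.presheaf _ _ _ _

end StalkHom

/-! ### §1 The relative basis of `Ω[K(𝒳 ⊗ 𝒳)⁄K(𝒳)]` from chart coordinates (two chart opens) -/

section Chart

variable {R : Type u} [CommRing R]
  (𝒳 : Over (Spec (.of R))) [IsIntegral 𝒳.left] [IsIntegral (𝒳 ⊗ 𝒳).left]
  [IsDominant (fst 𝒳 𝒳).left] [IsDominant (snd 𝒳 𝒳).left]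
  [Algebra 𝒳.left.functionField (𝒳 ⊗ 𝒳).left.functionField]

/-- **Chart form of C5′.**  Let `V₁, V₂` be affine opens of `𝒳` and `y*` sections over `V₂` whose differentials
form a basis of `Ω[Γ(V₂)⁄R]` (chart algebra structure).  Then `d_{K(𝒳)} (pr₂^♯ y*ᵢ)` is a basis of
`Ω[K(𝒳 ⊗ 𝒳)⁄K(𝒳)]` (`K(𝒳) → K(𝒳 ⊗ 𝒳) := pr₁^♯`): `Γ(pr₁⁻¹V₁ ∩ pr₂⁻¹V₂)` is the pushout
`Γ(V₁) ⊗_R Γ(V₂)` (Mathlib `isIso_pushoutSection_of_isAffineOpen`), so `Ω` of it over `Γ(V₁)` is the base change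
of `Ω[Γ(V₂)⁄R]`; then localise to `K(𝒳 ⊗ 𝒳)` and change the base `Γ(V₁) → K(𝒳)` (a localisation).
[cite: BLRNeronModels1990, §2.1 Prop. 3] -/
theorem exists_basis_kaehler_functionField_tensorObj_of_chart
    (hLM : algebraMap 𝒳.left.functionField (𝒳 ⊗ 𝒳).left.functionField =
      functionFieldMap (fst 𝒳 𝒳).left)
    {V₁ V₂ : 𝒳.left.Opens} (hV₁ : IsAffineOpen V₁) (hV₂ : IsAffineOpen V₂)
    (hη₁ : genericPoint 𝒳.left ∈ V₁) (hη₂ : genericPoint 𝒳.left ∈ V₂)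
    {ι : Type*} {z : ι → Γ(𝒳.left, V₂)}
    (b : letI : Algebra R Γ(𝒳.left, V₂) :=
        ((Scheme.ΓSpecIso (.of R)).inv ≫ 𝒳.hom.appLE ⊤ V₂ le_top).hom.toAlgebra
      Module.Basis ι Γ(𝒳.left, V₂) Ω[Γ(𝒳.left, V₂)⁄R])
    (hb : letI : Algebra R Γ(𝒳.left, V₂) :=
        ((Scheme.ΓSpecIso (.of R)).inv ≫ 𝒳.hom.appLE ⊤ V₂ le_top).hom.toAlgebra
      ∀ i, b i = KaehlerDifferential.D R _ (z i)) :
    ∃ B₂ : Module.Basis ι (𝒳 ⊗ 𝒳).left.functionField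
        Ω[(𝒳 ⊗ 𝒳).left.functionField⁄𝒳.left.functionField],
      ∀ i, B₂ i = KaehlerDifferential.D 𝒳.left.functionField _
        (functionFieldMap (snd 𝒳 𝒳).left
          (𝒳.left.presheaf.germ V₂ (genericPoint 𝒳.left) hη₂ (z i))) := by
  classical
  have H : IsPullback (fst 𝒳 𝒳).left (snd 𝒳 𝒳).left 𝒳.hom 𝒳.hom := IsPullback.of_hasPullback _ _
  -- the open `W = pr₁⁻¹V₁ ∩ pr₂⁻¹V₂` of `Y = (𝒳 ⊗ 𝒳).left` and its sections `C = Γ((𝒳 ⊗ 𝒳).left, W)`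
  let W : (𝒳 ⊗ 𝒳).left.Opens := (fst 𝒳 𝒳).left ⁻¹ᵁ V₁ ⊓ (snd 𝒳 𝒳).left ⁻¹ᵁ V₂
  have hW₁ : W ≤ (fst 𝒳 𝒳).left ⁻¹ᵁ V₁ := inf_le_left
  have hW₂ : W ≤ (snd 𝒳 𝒳).left ⁻¹ᵁ V₂ := inf_le_right
  have hηW : genericPoint (𝒳 ⊗ 𝒳).left ∈ W := by
    constructor
    · change (fst 𝒳 𝒳).left (genericPoint (𝒳 ⊗ 𝒳).left) ∈ V₁
      rw [genericPoint_eq_of_isDominant (fst 𝒳 𝒳).left]; exact hη₁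
    · change (snd 𝒳 𝒳).left (genericPoint (𝒳 ⊗ 𝒳).left) ∈ V₂
      rw [genericPoint_eq_of_isDominant (snd 𝒳 𝒳).left]; exact hη₂
  haveI : Nonempty W := ⟨⟨_, hηW⟩⟩
  haveI : Nonempty V₁ := ⟨⟨_, hη₁⟩⟩
  haveI : Nonempty V₂ := ⟨⟨_, hη₂⟩⟩
  -- `W` is affine: `W ≅ V₁ ×_{Spec R} V₂`
  haveI : IsAffine (⊤ : (Spec (CommRingCat.of R)).Opens).toScheme := isAffineOpen_top _
  haveI : IsAffine V₁.toScheme := hV₁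
  haveI : IsAffine V₂.toScheme := hV₂
  have hWaff : IsAffineOpen W :=
    .of_isIso (Scheme.Hom.isPullback_resLE H (US := ⊤) (UT := V₂) (UX := V₁) le_top le_top
      (UY := W) (by simp [W])).isoPullback.hom
  -- the algebra structures: `R → Γ(𝒳.left, V₁), Γ(𝒳.left, V₂)` (charts), `Γ(𝒳.left, V₁), Γ(𝒳.left, V₂) → C` (projections), `R → C`
  let a₁ : CommRingCat.of R ⟶ CommRingCat.of Γ(𝒳.left, V₁) := (Scheme.ΓSpecIso (.of R)).inv ≫ 𝒳.hom.appLE ⊤ V₁ le_top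
  let a₂ : CommRingCat.of R ⟶ CommRingCat.of Γ(𝒳.left, V₂) := (Scheme.ΓSpecIso (.of R)).inv ≫ 𝒳.hom.appLE ⊤ V₂ le_top
  let q₁ : CommRingCat.of Γ(𝒳.left, V₁) ⟶ CommRingCat.of Γ((𝒳 ⊗ 𝒳).left, W) := (fst 𝒳 𝒳).left.appLE V₁ W hW₁
  let q₂ : CommRingCat.of Γ(𝒳.left, V₂) ⟶ CommRingCat.of Γ((𝒳 ⊗ 𝒳).left, W) := (snd 𝒳 𝒳).left.appLE V₂ W hW₂
  have hsq : a₁ ≫ q₁ = a₂ ≫ q₂ := by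
    have key : ∀ (f g : (𝒳 ⊗ 𝒳).left ⟶ Spec (.of R)) (_ : f = g) (hf : W ≤ f ⁻¹ᵁ ⊤) (hg : W ≤ g ⁻¹ᵁ ⊤),
        f.appLE ⊤ W hf = g.appLE ⊤ W hg := by
      rintro f g rfl hf hg; rfl
    simp only [a₁, a₂, q₁, q₂, Category.assoc, Scheme.Hom.appLE_comp_appLE]
    rw [key ((fst 𝒳 𝒳).left ≫ 𝒳.hom) (𝒳 ⊗ 𝒳).hom (Over.w (fst 𝒳 𝒳)) _ le_top,
      key ((snd 𝒳 𝒳).left ≫ 𝒳.hom) (𝒳 ⊗ 𝒳).hom (Over.w (snd 𝒳 𝒳)) _ le_top]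
  letI iR₁ : Algebra R Γ(𝒳.left, V₁) := a₁.hom.toAlgebra
  letI iR₂ : Algebra R Γ(𝒳.left, V₂) := a₂.hom.toAlgebra
  letI i₁C : Algebra Γ(𝒳.left, V₁) Γ((𝒳 ⊗ 𝒳).left, W) := q₁.hom.toAlgebra
  letI i₂C : Algebra Γ(𝒳.left, V₂) Γ((𝒳 ⊗ 𝒳).left, W) := q₂.hom.toAlgebra
  letI iRC : Algebra R Γ((𝒳 ⊗ 𝒳).left, W) := (q₁.hom.comp a₁.hom).toAlgebra
  haveI : IsScalarTower R Γ(𝒳.left, V₁) Γ((𝒳 ⊗ 𝒳).left, W) := IsScalarTower.of_algebraMap_eq fun r => rfl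
  haveI : IsScalarTower R Γ(𝒳.left, V₂) Γ((𝒳 ⊗ 𝒳).left, W) := IsScalarTower.of_algebraMap_eq fun r => by
    change (a₁ ≫ q₁) r = (a₂ ≫ q₂) r
    rw [hsq]
  -- `C` is the pushout `Γ(𝒳.left, V₁) ⊗_R Γ(𝒳.left, V₂)`
  have hP : IsPushout (𝒳.hom.appLE ⊤ V₁ le_top) (𝒳.hom.appLE ⊤ V₂ le_top) q₁ q₂ :=
    (isIso_pushoutSection_iff H (US := ⊤) (UT := V₂) (UX := V₁) le_top le_top (UY := W)
      (by simp [W])).mp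
      (isIso_pushoutSection_of_isAffineOpen H le_top le_top (by simp [W]) (isAffineOpen_top _) hV₂ hV₁)
  have hP' : IsPushout a₁ a₂ q₁ q₂ := by
    refine IsPushout.of_iso hP (Scheme.ΓSpecIso (.of R)) (Iso.refl _) (Iso.refl _) (Iso.refl _)
      ?_ ?_ ?_ ?_ <;> simp [a₁, a₂]
  haveI hPush : Algebra.IsPushout R Γ(𝒳.left, V₁) Γ(𝒳.left, V₂) Γ((𝒳 ⊗ 𝒳).left, W) := by
    refine CommRingCat.isPushout_iff_isPushout.mp ?_
    have e₁ : CommRingCat.ofHom (algebraMap R Γ(𝒳.left, V₁)) = a₁ := rfl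
    have e₂ : CommRingCat.ofHom (algebraMap R Γ(𝒳.left, V₂)) = a₂ := rfl
    have e₃ : CommRingCat.ofHom (algebraMap Γ(𝒳.left, V₁) Γ((𝒳 ⊗ 𝒳).left, W)) = q₁ := rfl
    have e₄ : CommRingCat.ofHom (algebraMap Γ(𝒳.left, V₂) Γ((𝒳 ⊗ 𝒳).left, W)) = q₂ := rfl
    rw [e₁, e₂, e₃, e₄]
    exact hP'
  -- `Ω[Γ((𝒳 ⊗ 𝒳).left, W)⁄Γ(𝒳.left, V₁)]` has the basis `d (pr₂^♯ y*)` (base change of `Ω[Γ(𝒳.left, V₂)⁄R]`)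
  let bC : Module.Basis ι Γ((𝒳 ⊗ 𝒳).left, W) Ω[Γ((𝒳 ⊗ 𝒳).left, W)⁄Γ(𝒳.left, V₁)] :=
    (b.baseChange Γ((𝒳 ⊗ 𝒳).left, W)).map (KaehlerDifferential.tensorKaehlerEquiv R Γ(𝒳.left, V₁) Γ(𝒳.left, V₂) Γ((𝒳 ⊗ 𝒳).left, W))
  have hbC : ∀ i, bC i = KaehlerDifferential.D Γ(𝒳.left, V₁) Γ((𝒳 ⊗ 𝒳).left, W) (q₂ (z i)) := fun i => by
    simp only [bC, Module.Basis.map_apply, Module.Basis.baseChange_apply, hb,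
      KaehlerDifferential.tensorKaehlerEquiv_tmul_D, one_smul]
    rfl
  -- localise to the function field `M = Frac C`
  haveI : IsFractionRing Γ((𝒳 ⊗ 𝒳).left, W) (𝒳 ⊗ 𝒳).left.functionField := functionField_isFractionRing_of_isAffineOpen (𝒳 ⊗ 𝒳).left W hWaff
  letI i₁M : Algebra Γ(𝒳.left, V₁) (𝒳 ⊗ 𝒳).left.functionField := ((algebraMap Γ((𝒳 ⊗ 𝒳).left, W) (𝒳 ⊗ 𝒳).left.functionField).comp (algebraMap Γ(𝒳.left, V₁) Γ((𝒳 ⊗ 𝒳).left, W))).toAlgebra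
  haveI : IsScalarTower Γ(𝒳.left, V₁) Γ((𝒳 ⊗ 𝒳).left, W) (𝒳 ⊗ 𝒳).left.functionField := IsScalarTower.of_algebraMap_eq fun _ => rfl
  obtain ⟨bM, hbM⟩ := exists_basis_kaehler_localization_eq_D (𝒳 ⊗ 𝒳).left.functionField (nonZeroDivisors Γ((𝒳 ⊗ 𝒳).left, W)) bC hbC
  -- change the base `Γ(𝒳.left, V₁) → 𝒳.left.functionField = Frac Γ(𝒳.left, V₁)` (`Γ(𝒳.left, V₁) → 𝒳.left.functionField → M` is the tower through `pr₁^♯`)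
  haveI : IsFractionRing Γ(𝒳.left, V₁) 𝒳.left.functionField := functionField_isFractionRing_of_isAffineOpen 𝒳.left V₁ hV₁
  haveI : IsScalarTower Γ(𝒳.left, V₁) 𝒳.left.functionField (𝒳 ⊗ 𝒳).left.functionField := by
    refine IsScalarTower.of_algebraMap_eq fun s => ?_
    change algebraMap Γ((𝒳 ⊗ 𝒳).left, W) (𝒳 ⊗ 𝒳).left.functionField (q₁ s) = algebraMap 𝒳.left.functionField (𝒳 ⊗ 𝒳).left.functionField (algebraMap Γ(𝒳.left, V₁) 𝒳.left.functionField s)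
    rw [hLM]
    change (𝒳 ⊗ 𝒳).left.presheaf.germ W (genericPoint (𝒳 ⊗ 𝒳).left) (genericPoint_mem_opens_of_nonempty W) ((fst 𝒳 𝒳).left.appLE V₁ W hW₁ s) =
      functionFieldMap (fst 𝒳 𝒳).left (𝒳.left.presheaf.germ V₁ (genericPoint 𝒳.left)
        (genericPoint_mem_opens_of_nonempty V₁) s)
    exact germ_appLE_eq_functionFieldMap (fst 𝒳 𝒳).left hW₁ _ _ s
  let eL := Literature.RingTheory.Localization.kaehlerDifferentialEquivOfIsLocalization Γ(𝒳.left, V₁) 𝒳.left.functionField (𝒳 ⊗ 𝒳).left.functionField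
    (nonZeroDivisors Γ(𝒳.left, V₁))
  refine ⟨bM.map eL, fun i => ?_⟩
  rw [Module.Basis.map_apply, hbM,
    Literature.RingTheory.Localization.kaehlerDifferentialEquivOfIsLocalization_D]
  congr 1
  change (𝒳 ⊗ 𝒳).left.presheaf.germ W (genericPoint (𝒳 ⊗ 𝒳).left) (genericPoint_mem_opens_of_nonempty W) ((snd 𝒳 𝒳).left.appLE V₂ W hW₂ (z i)) = _
  rw [germ_appLE_eq_functionFieldMap (snd 𝒳 𝒳).left hW₂ hη₂ (genericPoint_mem_opens_of_nonempty W) (z i)]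

/-- **C5′ — relative rational coordinates on `𝒳 ⊗ 𝒳` over the first factor** (`stub_C5'` of B-p18's
`W0CoreStubsV2`, with the two work-file algebra instances pinned by `hRL`, `hLM`): let `𝒳 → Spec R` be smooth of
relative dimension `n` with integral total space and integral `𝒳 ⊗ 𝒳` (both projections dominant), `K(𝒳)` an
`R`-algebra through the structure map at the generic point and `K(𝒳 ⊗ 𝒳)` a `K(𝒳)`-algebra through `pr₁^♯`.
For ANY rational coordinates `y` on `𝒳` over `R` — `d y₁, …, d yₙ` a basis of `Ω[K(𝒳)⁄R]` — the differentials
`d (pr₂^♯ yᵢ)` form a basis of `Ω[K(𝒳 ⊗ 𝒳)⁄K(𝒳)]`.  Proof: chart coordinates `y*` (C1 ★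
`Smoothening.exists_affineChart_basis_eq_D`) satisfy it by `exists_basis_kaehler_functionField_tensorObj_of_chart`
(basis `W′`) and give a second basis `B′ = (d y*ᵢ)` of `Ω[K(𝒳)⁄R]`; by the chain rule along the ring map `pr₂^♯`
(★ `det_D_ringHom_eq`) `W′.det (d pr₂^♯ yⱼ)ⱼ = pr₂^♯ (B′.det (d yⱼ)ⱼ)` is a unit, so `(d pr₂^♯ yⱼ)ⱼ` is a basis
(Mathlib `is_basis_iff_det`). [cite: BLRNeronModels1990, §2.1 Prop. 3 and §2.2 Prop. 11] -/
theorem exists_basis_kaehler_functionField_tensorObj (n : ℕ) [SmoothOfRelativeDimension n 𝒳.hom]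
    [Algebra R 𝒳.left.functionField]
    (hRL : algebraMap R 𝒳.left.functionField = stalkHom 𝒳 (genericPoint 𝒳.left))
    (hLM : algebraMap 𝒳.left.functionField (𝒳 ⊗ 𝒳).left.functionField =
      functionFieldMap (fst 𝒳 𝒳).left)
    {y : Fin n → 𝒳.left.functionField}
    (B₀ : Module.Basis (Fin n) 𝒳.left.functionField Ω[𝒳.left.functionField⁄R])
    (hB₀ : ∀ i, B₀ i = KaehlerDifferential.D R _ (y i)) :
    ∃ B₂ : Module.Basis (Fin n) (𝒳 ⊗ 𝒳).left.functionField
        Ω[(𝒳 ⊗ 𝒳).left.functionField⁄𝒳.left.functionField],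
      ∀ i, B₂ i = KaehlerDifferential.D 𝒳.left.functionField _
        (functionFieldMap (snd 𝒳 𝒳).left (y i)) := by
  classical
  -- a chart `V ∋ η` with an exact basis `d y*` of `Ω[Γ(V)⁄R]`
  obtain ⟨V, hV, hηV, z, b, hb⟩ :=
    Literature.AlgebraicGeometry.Smoothening.exists_affineChart_basis_eq_D 𝒳.hom n (genericPoint 𝒳.left)
  haveI : Nonempty V := ⟨⟨_, hηV⟩⟩
  -- the relative basis `W′ = (d pr₂^♯ y*ᵢ)` from the chart
  obtain ⟨W', hW'⟩ :=
    exists_basis_kaehler_functionField_tensorObj_of_chart 𝒳 hLM hV hV hηV hηV b hb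
  -- the second basis `B′ = (d y*ᵢ)` of `Ω[K(𝒳)⁄R]`
  letI : Algebra R Γ(𝒳.left, V) :=
    ((Scheme.ΓSpecIso (.of R)).inv ≫ 𝒳.hom.appLE ⊤ V le_top).hom.toAlgebra
  haveI : IsScalarTower R Γ(𝒳.left, V) 𝒳.left.functionField := by
    refine IsScalarTower.of_algebraMap_eq fun r => ?_
    rw [hRL, ← germ_comp_chartAlgebraMap 𝒳 V hηV]
    rfl
  haveI : IsFractionRing Γ(𝒳.left, V) 𝒳.left.functionField :=
    functionField_isFractionRing_of_isAffineOpen 𝒳.left V hV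
  obtain ⟨B', hB'⟩ := exists_basis_kaehler_localization_eq_D 𝒳.left.functionField
    (nonZeroDivisors Γ(𝒳.left, V)) b hb
  have hB'' : ∀ i, B' i = KaehlerDifferential.D R 𝒳.left.functionField
      (𝒳.left.presheaf.germ V (genericPoint 𝒳.left) hηV (z i)) := fun i => by
    rw [hB' i]; rfl
  -- the chain rule along `pr₂^♯`
  have hστ : (functionFieldMap (snd 𝒳 𝒳).left).comp (algebraMap R 𝒳.left.functionField) =
      (algebraMap 𝒳.left.functionField (𝒳 ⊗ 𝒳).left.functionField).comp
        (algebraMap R 𝒳.left.functionField) := by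
    rw [hRL, hLM, functionFieldMap_comp_stalkHom (snd 𝒳 𝒳), functionFieldMap_comp_stalkHom (fst 𝒳 𝒳)]
  have hdet := det_D_ringHom_eq (algebraMap R 𝒳.left.functionField) (functionFieldMap (snd 𝒳 𝒳).left)
    hστ B' hB'' W' hW' y
  have hunit : IsUnit (W'.det fun j => KaehlerDifferential.D 𝒳.left.functionField
      (𝒳 ⊗ 𝒳).left.functionField (functionFieldMap (snd 𝒳 𝒳).left (y j))) := by
    rw [hdet]
    refine RingHom.isUnit_map _ ?_
    have hfun : (fun j => KaehlerDifferential.D R 𝒳.left.functionField (y j)) = ⇑B₀ :=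
      funext fun j => (hB₀ j).symm
    rw [hfun]
    exact B'.isUnit_det B₀
  obtain ⟨hli, hsp⟩ := (Module.Basis.is_basis_iff_det W').mpr hunit
  exact ⟨Module.Basis.mk hli hsp.ge, fun i => Module.Basis.mk_apply hli hsp.ge i⟩

end Chart

end Literature.AlgebraicGeometry.Motives

end
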